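import Summits.Ventures.PercRepro.RLSRulePlus

/-!
# PercRepro — Lemma R for the lifted rule `R₃⁺`: the per-flat inequality passes from the reduced world
`M | (G ∪ K)` to `M` (night-3, gen 3)

The lane proves its per-flat inequalities in the REDUCED WORLD `E = G ⊔ K`, `K` a basis of `M | (E ∖ G)`
(`proofs/N3-R3PLUS-plan.md` §2, «Lemma R (19.1) holds for every rule depending on `M|S` only»).  This file is that
lemma in the kernel, for the rule `wPlus` of `RLSRulePlus.lean`: for a plane `G ⊆ R ⊆ E` such that `R ∖ G` spans
`E ∖ R` (`M.E ∖ R ⊆ M.closure (R ∖ G)` — e.g. `R = G ∪ K` with `K` a basis of `E ∖ G`),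

* the rule is RESTRICTION-INVARIANT: for `S ⊆ R` the `R₃⁺` share of `G` in `S` is the same in `M` and in `M ↾ R`
  (`wPlus_restrict`) — the planes of `M ↾ R` are the traces `G′ ∩ R` of rank `3` of the planes `G′` of `M`
  (`inter_mem_flatsQ_restrict`, `clF_mem_flatsQ_of_mem_restrict`), `ρ₃`, the trace types and `m*` are read inside
  `S ⊆ R` (`rho3_restrict`, `nonT0_restrict_iff`, `mstar_restrict`), and the normalising sums agree
  (`sum_fPlus_restrict`);
* the DEMAND is the same: `UqG (M ↾ R) p 3 G = UqG M p 3 G` (`UqG_restrict_eq`: a bottom set `B ⊆ G` has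
  `ρ(E ∖ B) = ρ(R ∖ B)` because `E ∖ R` lies in the closure of `R ∖ G ⊆ R ∖ B`);
* the SUPPLY only grows: `Yq (M ↾ R) p 3 ⊆ Yq M p 3` (`Yq_restrict_subset`) with equal summands;
* **`perFlat_of_restrict`** — the per-flat inequality for `G` in `M ↾ R` implies it for `G` in `M`.
Imports `RLSRulePlus`.  Axioms: standard.
-/

open scoped Matroid

namespace PercRepro

namespace NightThree

open Finset ThmH PerFlat

variable {α : Type*} [DecidableEq α] {M : Matroid α} [M.Finite]

omit [DecidableEq α] in
/-- A plane has rank `3` (numeral form). -/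
theorem eRk_eq_three_of_mem_flatsQ {G : Finset α} (hG : G ∈ flatsQ M 3) : M.eRk (G : Set α) = 3 := by
  rw [flatsQ_three] at hG
  exact (mem_planes.1 hG).2.2

/-- The restriction of a finite matroid to a finset is finite. -/
instance restrictFinset_finite (M : Matroid α) (R : Finset α) : (M ↾ (R : Set α)).Finite :=
  Matroid.restrict_finite R.finite_toSet

/-! ### The ground set, ranks, independence and `ρ₃` of a restriction -/

omit [DecidableEq α] [M.Finite] in
/-- The ground finset of `M ↾ R` is `R`. -/
theorem gr_restrict (R : Finset α) : gr (M ↾ (R : Set α)) = R := by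
  apply Finset.coe_injective
  rw [coe_gr, Matroid.restrict_ground_eq]

omit [DecidableEq α] [M.Finite] in
/-- Ranks of subsets of `R` agree. -/
theorem eRk_restrict_eq {R X : Finset α} (hX : X ⊆ R) :
    (M ↾ (R : Set α)).eRk (X : Set α) = M.eRk (X : Set α) :=
  Matroid.restrict_eRk_eq M (Finset.coe_subset.2 hX)

omit [DecidableEq α] [M.Finite] in
/-- Independence of subsets of `R` agrees. -/
theorem indep_restrict_iff {R X : Finset α} (hX : X ⊆ R) :
    (M ↾ (R : Set α)).Indep (X : Set α) ↔ M.Indep (X : Set α) := by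
  rw [Matroid.restrict_indep_iff]
  exact ⟨fun h => h.1, fun h => ⟨h, Finset.coe_subset.2 hX⟩⟩

omit [DecidableEq α] [M.Finite] in
/-- `ρ₃` of a subset of `R` agrees. -/
theorem rho3_restrict {R F : Finset α} (hF : F ⊆ R) : rho3 (M ↾ (R : Set α)) F = rho3 M F := by
  classical
  unfold rho3
  congr 1
  ext T
  simp only [Finset.mem_filter, Finset.mem_powersetCard]
  constructor
  · rintro ⟨⟨hTF, hTc⟩, hTi⟩
    exact ⟨⟨hTF, hTc⟩, (indep_restrict_iff (hTF.trans hF)).1 hTi⟩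
  · rintro ⟨⟨hTF, hTc⟩, hTi⟩
    exact ⟨⟨hTF, hTc⟩, (indep_restrict_iff (hTF.trans hF)).2 hTi⟩

omit [DecidableEq α] [M.Finite] in
/-- Long lines inside a subset of `R` agree. -/
theorem hasLongLine_restrict_iff {R F : Finset α} (hF : F ⊆ R) :
    HasLongLine (M ↾ (R : Set α)) F ↔ HasLongLine M F := by
  unfold HasLongLine
  constructor
  · rintro ⟨L, hL, hr⟩
    refine ⟨L, hL, ?_⟩
    rwa [eRk_restrict_eq ((Finset.mem_powersetCard.1 hL).1.trans hF)] at hr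
  · rintro ⟨L, hL, hr⟩
    refine ⟨L, hL, ?_⟩
    rwa [eRk_restrict_eq ((Finset.mem_powersetCard.1 hL).1.trans hF)]

omit [DecidableEq α] [M.Finite] in
/-- The trace type of a subset of `R` agrees. -/
theorem nonT0_restrict_iff {R F : Finset α} (hF : F ⊆ R) :
    NonT0 (M ↾ (R : Set α)) F ↔ NonT0 M F := by
  unfold NonT0
  rw [eRk_restrict_eq hF, hasLongLine_restrict_iff hF]

/-! ### The planes of a restriction -/

/-- The closure of a subset of `R` in `M ↾ R` is the closure in `M`, cut to `R`. -/
theorem clF_restrict {R X : Finset α} (hR : R ⊆ gr M) (hX : X ⊆ R) :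
    clF (M ↾ (R : Set α)) X = clF M X ∩ R := by
  apply Finset.coe_injective
  rw [coe_clF, Finset.coe_inter, coe_clF]
  exact Matroid.restrict_closure_eq M (Finset.coe_subset.2 hX)
    (by rw [← coe_gr M]; exact Finset.coe_subset.2 hR)

/-- The rank-`3` trace on `R` of a plane of `M` is a plane of `M ↾ R`. -/
theorem inter_mem_flatsQ_restrict {R G : Finset α} (hR : R ⊆ gr M) (hG : G ∈ flatsQ M 3)
    (h3 : M.eRk ((G ∩ R : Finset α) : Set α) = 3) : G ∩ R ∈ flatsQ (M ↾ (R : Set α)) 3 := by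
  obtain ⟨hGE, hGflat, hGr⟩ := mem_flatsQ.1 hG
  rw [mem_flatsQ, gr_restrict, eRk_restrict_eq Finset.inter_subset_right]
  refine ⟨Finset.inter_subset_right, ?_, h3⟩
  rw [Matroid.isFlat_iff_closure_eq, Matroid.restrict_closure_eq M (Finset.coe_subset.2 Finset.inter_subset_right)
    (by rw [← coe_gr M]; exact Finset.coe_subset.2 hR)]
  apply subset_antisymm
  · intro x hx
    rw [Set.mem_inter_iff] at hx
    have hx1 : x ∈ M.closure (G : Set α) :=
      M.closure_subset_closure (Finset.coe_subset.2 Finset.inter_subset_left) hx.1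
    rw [hGflat.closure] at hx1
    rw [Finset.coe_inter, Set.mem_inter_iff]
    exact ⟨hx1, hx.2⟩
  · intro x hx
    rw [Set.mem_inter_iff]
    refine ⟨M.subset_closure _ ?_ hx, ?_⟩
    · rw [← coe_gr M]
      exact Finset.coe_subset.2 (Finset.inter_subset_left.trans hGE)
    · rw [Finset.coe_inter, Set.mem_inter_iff] at hx
      exact hx.2

/-- A plane of `M ↾ R` is the trace on `R` of its closure in `M`, which is a plane of `M`. -/
theorem clF_mem_flatsQ_of_mem_restrict {R H : Finset α} (hR : R ⊆ gr M)
    (hH : H ∈ flatsQ (M ↾ (R : Set α)) 3) : clF M H ∈ flatsQ M 3 ∧ clF M H ∩ R = H := by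
  obtain ⟨hHR, hHflat, hHr⟩ := mem_flatsQ.1 hH
  rw [gr_restrict] at hHR
  rw [eRk_restrict_eq hHR] at hHr
  refine ⟨?_, ?_⟩
  · rw [flatsQ_three]
    exact (clF_mem_planes (hHR.trans hR) hHr).1
  · rw [← clF_restrict hR hHR]
    apply Finset.coe_injective
    rw [coe_clF]
    exact hHflat.closure

/-- Two planes of `M` with the same rank-`3` trace on `R` coincide. -/
theorem eq_of_inter_eq {R G G' : Finset α} (hG : G ∈ flatsQ M 3) (hG' : G' ∈ flatsQ M 3)
    (h3 : M.eRk ((G ∩ R : Finset α) : Set α) = 3) (h : G ∩ R = G' ∩ R) : G = G' := by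
  rw [flatsQ_three] at hG hG'
  exact planes_eq_of_subset hG hG' Finset.inter_subset_left (h ▸ Finset.inter_subset_left) h3

omit [DecidableEq α] in
/-- A rank-`3` subset of a plane spans it: `ρ(G ∩ R) = 3` as soon as `ρ₃(G ∩ S) > 0` for some `S ⊆ R`. -/
theorem eRk_eq_three_of_rho3_pos {G F : Finset α} (hG : G ∈ flatsQ M 3) (hF : F ⊆ G)
    (h : 0 < rho3 M F) : M.eRk (F : Set α) = 3 := by
  classical
  unfold rho3 at h
  obtain ⟨T, hT⟩ := Finset.card_pos.1 h
  simp only [Finset.mem_filter, Finset.mem_powersetCard] at hT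
  have h3 : M.eRk (T : Set α) = 3 := eRk_eq_three_of_indep_card hT.2 hT.1.2
  apply le_antisymm
  · rw [← eRk_eq_three_of_mem_flatsQ hG]
    exact M.eRk_mono (Finset.coe_subset.2 hF)
  · rw [← h3]
    exact M.eRk_mono (Finset.coe_subset.2 hT.1.1)

/-! ### `m*`, the weights and the shares of a restriction -/

/-- For `S ⊆ R`, the trace of `G ∩ R` on `S` is the trace of `G`. -/
theorem inter_inter_eq {R G S : Finset α} (hS : S ⊆ R) : (G ∩ R) ∩ S = G ∩ S := by
  rw [Finset.inter_assoc, Finset.inter_eq_right.2 hS]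

/-- `m*` is read inside `S ⊆ R`: it agrees in `M` and in `M ↾ R`. -/
theorem mstar_restrict {R S : Finset α} (hR : R ⊆ gr M) (hS : S ⊆ R) :
    mstar (M ↾ (R : Set α)) S = mstar M S := by
  classical
  apply le_antisymm
  · unfold mstar
    apply Finset.sup_le
    intro H hH
    rw [Finset.mem_filter] at hH
    obtain ⟨hG, hGR⟩ := clF_mem_flatsQ_of_mem_restrict hR hH.1
    have hn : NonT0 M (clF M H ∩ S) := by
      rw [← inter_inter_eq hS, hGR]
      exact (nonT0_restrict_iff (Finset.inter_subset_right.trans hS)).1 hH.2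
    have hmem : clF M H ∈ (flatsQ M 3).filter (fun G => NonT0 M (G ∩ S)) :=
      Finset.mem_filter.2 ⟨hG, hn⟩
    have := Finset.le_sup (f := fun G => (G ∩ S).card) hmem
    rwa [← inter_inter_eq hS, hGR] at this
  · unfold mstar
    apply Finset.sup_le
    intro G hG
    rw [Finset.mem_filter] at hG
    have h3 : M.eRk ((G ∩ R : Finset α) : Set α) = 3 := by
      apply le_antisymm
      · rw [← eRk_eq_three_of_mem_flatsQ hG.1]
        exact M.eRk_mono (Finset.coe_subset.2 Finset.inter_subset_left)
      · rw [← hG.2.1]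
        exact M.eRk_mono (Finset.coe_subset.2 (Finset.inter_subset_inter_left hS))
    have hH : G ∩ R ∈ flatsQ (M ↾ (R : Set α)) 3 := inter_mem_flatsQ_restrict hR hG.1 h3
    have hn : NonT0 (M ↾ (R : Set α)) ((G ∩ R) ∩ S) := by
      rw [inter_inter_eq hS]
      exact (nonT0_restrict_iff (Finset.inter_subset_right.trans hS)).2 hG.2
    have hmem : G ∩ R ∈ (flatsQ (M ↾ (R : Set α)) 3).filter
        (fun G' => NonT0 (M ↾ (R : Set α)) (G' ∩ S)) := Finset.mem_filter.2 ⟨hH, hn⟩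
    have := Finset.le_sup (f := fun G' => (G' ∩ S).card) hmem
    rwa [inter_inter_eq hS] at this

/-- The weight of `G` in `S ⊆ R` is the weight of its trace `G ∩ R` in `M ↾ R`. -/
theorem fPlus_restrict {R G S : Finset α} (hR : R ⊆ gr M) (hS : S ⊆ R) :
    fPlus (M ↾ (R : Set α)) (G ∩ R) S = fPlus M G S := by
  unfold fPlus
  rw [mstar_restrict hR hS, inter_inter_eq hS,
    rho3_restrict (Finset.inter_subset_right.trans hS)]
  by_cases h0 : mstar M S = 0
  · rw [if_pos h0, if_pos h0]
  · rw [if_neg h0, if_neg h0]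
    by_cases hc : NonT0 M (G ∩ S) ∧ (G ∩ S).card = mstar M S
    · rw [if_pos hc, if_pos (show NonT0 (M ↾ (R : Set α)) (G ∩ S) ∧ (G ∩ S).card = mstar M S from
        ⟨(nonT0_restrict_iff (Finset.inter_subset_right.trans hS)).2 hc.1, hc.2⟩)]
    · rw [if_neg hc, if_neg (show ¬ (NonT0 (M ↾ (R : Set α)) (G ∩ S) ∧ (G ∩ S).card = mstar M S) from
        fun h => hc ⟨(nonT0_restrict_iff (Finset.inter_subset_right.trans hS)).1 h.1, h.2⟩)]

/-- A nonzero weight forces a rank-`3` trace. -/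
theorem eRk_inter_eq_three_of_fPlus_ne_zero {R G S : Finset α} (hG : G ∈ flatsQ M 3) (hS : S ⊆ R)
    (h : fPlus M G S ≠ 0) : M.eRk ((G ∩ R : Finset α) : Set α) = 3 := by
  have hpos : 0 < rho3 M (G ∩ S) := by
    by_contra hle
    push Not at hle
    have h0 : rho3 M (G ∩ S) = 0 := Nat.le_zero.1 hle
    apply h
    unfold fPlus
    rw [h0]
    split_ifs <;> simp
  have h3 : M.eRk ((G ∩ S : Finset α) : Set α) = 3 :=
    eRk_eq_three_of_rho3_pos hG Finset.inter_subset_left hpos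
  apply le_antisymm
  · rw [← eRk_eq_three_of_mem_flatsQ hG]
    exact M.eRk_mono (Finset.coe_subset.2 Finset.inter_subset_left)
  · rw [← h3]
    exact M.eRk_mono (Finset.coe_subset.2 (Finset.inter_subset_inter_left hS))

/-- The normalising sums agree: `Σ_{G ∈ planes(M)} f⁺(G, S) = Σ_{H ∈ planes(M ↾ R)} f⁺(H, S)` for `S ⊆ R`. -/
theorem sum_fPlus_restrict {R S : Finset α} (hR : R ⊆ gr M) (hS : S ⊆ R) :
    ∑ G ∈ flatsQ M 3, fPlus M G S = ∑ H ∈ flatsQ (M ↾ (R : Set α)) 3, fPlus (M ↾ (R : Set α)) H S := by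
  classical
  refine Finset.sum_bij_ne_zero (fun G _ _ => G ∩ R) ?_ ?_ ?_ ?_
  · intro G hG hne
    exact inter_mem_flatsQ_restrict hR hG (eRk_inter_eq_three_of_fPlus_ne_zero hG hS hne)
  · intro G hG hne G' hG' _ h
    exact eq_of_inter_eq hG hG' (eRk_inter_eq_three_of_fPlus_ne_zero hG hS hne) h
  · intro H hH hne
    obtain ⟨hG, hGR⟩ := clF_mem_flatsQ_of_mem_restrict hR hH
    refine ⟨clF M H, hG, ?_, hGR⟩
    rwa [← fPlus_restrict hR hS, hGR]
  · intro G _ _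
    exact (fPlus_restrict hR hS).symm

/-- **Restriction invariance of `R₃⁺`.**  For `G, S ⊆ R`, the share of `G` in `S` is the same in `M` and in
`M ↾ R`. -/
theorem wPlus_restrict {R G S : Finset α} (hR : R ⊆ gr M) (hG : G ⊆ R) (hS : S ⊆ R) :
    wPlus (M ↾ (R : Set α)) G S = wPlus M G S := by
  unfold wPlus
  rw [← sum_fPlus_restrict hR hS, ← fPlus_restrict hR hS, Finset.inter_eq_left.2 hG]

/-! ### Supply and demand of a restriction -/

omit [DecidableEq α] in
/-- The middle level of `M ↾ R` is part of the middle level of `M`. -/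
theorem Yq_restrict_subset {R : Finset α} (hR : R ⊆ gr M) (p q : ℕ) :
    Yq (M ↾ (R : Set α)) p q ⊆ Yq M p q := by
  intro S hS
  unfold Yq at hS ⊢
  rw [Finset.mem_filter, Finset.mem_powerset, gr_restrict] at hS
  rw [Finset.mem_filter, Finset.mem_powerset]
  rw [eRk_restrict_eq hS.1] at hS
  exact ⟨hS.1.trans hR, hS.2⟩

/-- **The demand is unchanged.**  If `R ∖ G` spans `E ∖ R`, the bottom sets inside `G ⊆ R` are the same in `M` and
in `M ↾ R`. -/
theorem UqG_restrict_eq {R G : Finset α} (hR : R ⊆ gr M) (hG : G ⊆ R)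
    (hspan : M.E \ (R : Set α) ⊆ M.closure ((R \ G : Finset α) : Set α)) (p q : ℕ) :
    UqG (M ↾ (R : Set α)) p q G = UqG M p q G := by
  have hRE : (R : Set α) ⊆ M.E := by rw [← coe_gr M]; exact Finset.coe_subset.2 hR
  ext B
  unfold UqG
  rw [Finset.mem_filter, Finset.mem_filter, mem_Uq, mem_Uq, gr_restrict]
  constructor
  · rintro ⟨⟨hBR, hBq, hBp⟩, hBG⟩
    rw [eRk_restrict_eq hBR] at hBq
    rw [eRk_restrict_eq Finset.sdiff_subset] at hBp
    refine ⟨⟨hBR.trans hR, hBq, ?_⟩, hBG⟩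
    rw [← hBp]
    apply le_antisymm
    · have hsub : ((gr M \ B : Finset α) : Set α) ⊆ M.closure ((R \ B : Finset α) : Set α) := by
        intro x hx
        rw [Finset.coe_sdiff, Set.mem_sdiff, coe_gr] at hx
        by_cases hxR : x ∈ (R : Set α)
        · exact M.subset_closure _ (Finset.coe_subset.2 Finset.sdiff_subset |>.trans hRE)
            (by rw [Finset.coe_sdiff, Set.mem_sdiff]; exact ⟨hxR, hx.2⟩)
        · have hx' : x ∈ M.closure ((R \ G : Finset α) : Set α) := hspan ⟨hx.1, hxR⟩
          exact M.closure_subset_closure (Finset.coe_subset.2 (Finset.sdiff_subset_sdiff le_rfl hBG)) hx'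
      calc M.eRk ((gr M \ B : Finset α) : Set α)
          ≤ M.eRk (M.closure ((R \ B : Finset α) : Set α)) := M.eRk_mono hsub
        _ = M.eRk ((R \ B : Finset α) : Set α) := M.eRk_closure_eq _
    · exact M.eRk_mono (Finset.coe_subset.2 (Finset.sdiff_subset_sdiff hR le_rfl))
  · rintro ⟨⟨_, hBq, hBp⟩, hBG⟩
    have hBR : B ⊆ R := hBG.trans hG
    refine ⟨⟨hBR, ?_, ?_⟩, hBG⟩
    · rw [eRk_restrict_eq hBR]; exact hBq
    · rw [eRk_restrict_eq Finset.sdiff_subset, ← hBp]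
      apply le_antisymm
      · exact M.eRk_mono (Finset.coe_subset.2 (Finset.sdiff_subset_sdiff hR le_rfl))
      · have hsub : ((gr M \ B : Finset α) : Set α) ⊆ M.closure ((R \ B : Finset α) : Set α) := by
          intro x hx
          rw [Finset.coe_sdiff, Set.mem_sdiff, coe_gr] at hx
          by_cases hxR : x ∈ (R : Set α)
          · exact M.subset_closure _ (Finset.coe_subset.2 Finset.sdiff_subset |>.trans hRE)
              (by rw [Finset.coe_sdiff, Set.mem_sdiff]; exact ⟨hxR, hx.2⟩)
          · have hx' : x ∈ M.closure ((R \ G : Finset α) : Set α) := hspan ⟨hx.1, hxR⟩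
            exact M.closure_subset_closure (Finset.coe_subset.2 (Finset.sdiff_subset_sdiff le_rfl hBG)) hx'
        calc M.eRk ((gr M \ B : Finset α) : Set α)
            ≤ M.eRk (M.closure ((R \ B : Finset α) : Set α)) := M.eRk_mono hsub
          _ = M.eRk ((R \ B : Finset α) : Set α) := M.eRk_closure_eq _

/-- **Lemma R for `R₃⁺`.**  If `R ∖ G` spans `E ∖ R` (the reduced world `R = G ∪ K`, `K` a basis of `E ∖ G`), the
per-flat inequality for the plane `G` in `M ↾ R` implies it in `M`: the demand is the same and every witness of
`M ↾ R` is a witness of `M` with the same share. -/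
theorem perFlat_of_restrict {R G : Finset α} (hR : R ⊆ gr M) (hG : G ⊆ R)
    (hspan : M.E \ (R : Set α) ⊆ M.closure ((R \ G : Finset α) : Set α)) (p : ℕ) {c : ℚ}
    (h : c * ((UqG (M ↾ (R : Set α)) p 3 G).card : ℚ) ≤ ∑ S ∈ Yq (M ↾ (R : Set α)) p 3, wPlus (M ↾ (R : Set α)) G S) :
    c * ((UqG M p 3 G).card : ℚ) ≤ ∑ S ∈ Yq M p 3, wPlus M G S := by
  rw [UqG_restrict_eq hR hG hspan] at h
  refine h.trans ?_
  calc ∑ S ∈ Yq (M ↾ (R : Set α)) p 3, wPlus (M ↾ (R : Set α)) G S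
      = ∑ S ∈ Yq (M ↾ (R : Set α)) p 3, wPlus M G S := by
        apply Finset.sum_congr rfl
        intro S hS
        have hSR : S ⊆ R := by
          unfold Yq at hS
          rw [Finset.mem_filter, Finset.mem_powerset, gr_restrict] at hS
          exact hS.1
        exact wPlus_restrict hR hG hSR
    _ ≤ ∑ S ∈ Yq M p 3, wPlus M G S :=
        Finset.sum_le_sum_of_subset_of_nonneg (Yq_restrict_subset hR p 3)
          (fun S _ _ => wPlus_nonneg M G S)

end NightThree

end PercRepro
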